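import Summits.BirchSwinnertonDyer.BirchSwinnertonDyer.Theorems.EisensteinPrimesBSDpOnCellCAcDescentOfInputs
import Mathlib.Algebra.Module.CharacterModule
import HarnessLib

/-!
# Crux 4 `BSDpOnCellC` (stmt-BirchSwinnertonDyer-19034), line «crystal» v10, stub `stub_acDescent`: the CONTROL input (Ctrl) from
# the FIXED-POINT input «`E(K̃_∞)[p^∞]` has finite exponent» — the cokernel of `X_Gr(E_K/K̃_∞)/T₁ → X_ac^∅(E_K)` is killed by the
# exponent of `E(K̃_∞)[p^∞]` (cell `bsd-eis`, width seat `bsd-line-x2-p2` gen 14; `--supports stmt-BirchSwinnertonDyer-19034`; skeleton of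
# record UNCHANGED, W-79)

WHY. `…AcDescentOfInputs.acDescent_of_inputs` (this seat) reads `stub_acDescent ⟸ (FE) ∧ (Ctrl)`, with (Ctrl) = «a `Λ`-linear control map
`X_Gr₂/T₁X_Gr₂ → X_ac^∅(E_K)(𝔭̄)` whose cokernel has finite exponent», discharged there only when `E(K)[p] = 0` (then the tree's
`XGr₂.toXAcQuot` is onto). On cell C `E(ℚ)[p] ≠ 0` happens (rational `p`-isogeny with trivial character), so the general case matters. The
cokernel of `toXAcQuot` is the Pontryagin dual of `ker(Sel_𝔭̄(K_∞^{ac}, E[p^∞]) → H¹_{nr,𝔭̄}(K̃_∞, E[p^∞]))`, which sits in the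
inflation–restriction kernel `H¹(Gal(K̃_∞/K_∞^{ac}), E(K̃_∞)[p^∞])` (Greenberg LNM 1716 Lemma 3.1), killed by the exponent of `E(K̃_∞)[p^∞]`.

WHAT IS PROVED (kernel-checked; no named fact, no definition):
* §1 `nsmul_eq_zero_of_resOfLe_eq_zero` — **inflation–restriction, torsion form**: for `H' ≤ H ≤ G`, `H'` normal, and a discrete `G`-module
  `M` whose `H'`-fixed points are killed by `n`, every class of `H¹(H, M)` restricting to `0` on `H'` is killed by `n` (on cocycles:
  `z|_{H'} = ∂a` ⟹ `z(h) − (h·a − a) ∈ M^{H'}`, the computation of the tree's `resOfLe_injective_of_forall_fixed_eq_zero`).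
* §2 `AddMonoidHom.exists_comp_eq_of_forall_ker_apply` — a character `χ : S → ℚ/ℤ` vanishing on `ker r` (`r : S →+ S'`) is `x ∘ r`
  (divisibility of `ℚ/ℤ`; the tree's `exists_comp_eq_of_forall_ker` is the endomorphism case).
* §3 for an elliptic curve `W` over a number field `K`, `κ₁, κ`, a generator pair `(γ₁, γ')`, `v̄`: if `p^a` kills
  `E[p^∞]^{Gal(K̄/K̃_∞)}` then `p^a` kills `ker(selmerAcToUnrSelmer₂)` (`pow_smul_eq_zero_of_selmerAcToUnrSelmer₂_eq_zero`), every
  `p^a · y`, `y ∈ X_ac^∅`, is `toXAc x` (`XGr₂.exists_toXAc_eq_pow_smul`), and **`AcDescent.control_of_fixedExponent`**: (Ctrl) holds with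
  exponent `a`. `AcDescent.fixedExponent_of_noPTorsion`: `E(K)[p] = 0 ⟹` exponent `p^0` (tree `eq_zero_of_forall_pairKer_smul_eq`).
* §4 **`AcDescent.acDescent_of_inputs_fe : (FE) → (TPfe) → <stub_acDescent VERBATIM>`** with (TPfe) = «for every cell-C datum and
  cyclotomic/anticyclotomic pair, `∃ a, p^a · E_K[p^∞]^{Gal(K̄/K̃_∞)} = 0`» — TRUE for every non-CM curve (a `Γ_K`-stable `p`-divisible
  line in `E[p^∞]` rational over the abelian `K̃_∞` would contradict open image; `E[p] ⊄ E(K̃_∞)` as `μ_p ⊄ K̃_∞` for `p` odd), hence on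
  all of cell C (multiplicative reduction at `p` excludes CM), but NOT proved here: it is the honest residual input next to (FE).

HONEST FRAMING: CONDITIONAL reduction; `stub_acDescent` is NOT closed; nothing about any curve's Selmer group is asserted; no summit
statement / BSD / MC / IMC is proved for any curve; 0 cells / labels / tiers move.

References: [GreenbergLNM1716] §3 Lemma 3.1 (PDF p. 86), §4 proof of Prop. 4.8 (PDF p. 109); [SkinnerUrban2014] §3.2.7–3.2.8 (p. 23);
[SerreLocalFields1979] VII §6 Prop. 4 (inflation–restriction); [Castella2018] Def. 2.2; tree `TwoVariableAnticyclotomicControl`,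
`SignedBaseChangeAnticyclotomicEisensteinDivisibilityExactControlDuality` (§1 pattern), `Lines/crystal.lean` v10.
-/

set_option autoImplicit false
set_option linter.dupNamespace false

noncomputable section

open scoped Classical

universe u

/-! ## §1 Inflation–restriction, torsion form: `ker(res)` is killed by the exponent of `M^{H'}` -/

namespace Literature.NumberTheory.EllipticCurves

open Literature.NumberTheory.GaloisRepresentations

section InfRes

variable {G : Type u} [Group G] [TopologicalSpace G] [IsTopologicalGroup G]
  {M : Type u} [AddCommGroup M] [DistribMulAction G M] [TopologicalSpace M] [DiscreteTopology M]

/-- **Inflation–restriction, torsion form.** For subgroups `H' ≤ H` of a topological group `G` with `H'` normal in `G`, a discrete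
`G`-module `M` whose `H'`-fixed points are killed by `n`, and a class `c ∈ H¹(H, M)` with `res_{H'} c = 0`: `n · c = 0`. On cocycles: if
`z|_{H'} = ∂a` then `b(h) = z(h) − (h·a − a)` is `H'`-fixed for every `h ∈ H` (expand `z(x h) = z(h · h⁻¹ x h)` both ways, as in the
tree's `resOfLe_injective_of_forall_fixed_eq_zero`), so `n · b = 0` and `n · z = ∂(n · a)`. (The kernel of `res` is
`H¹(H/H', M^{H'})`, Greenberg LNM 1716 Lemma 3.1.) [cite: GreenbergLNM1716, §3 Lemma 3.1 (PDF p. 86)]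
[cite: SerreLocalFields1979, VII §6 Prop. 4] -/
theorem nsmul_eq_zero_of_resOfLe_eq_zero {H H' : Subgroup G} [hH' : H'.Normal] (hle : H' ≤ H) {n : ℕ}
    (hfix : ∀ m : M, (∀ x ∈ H', x • m = m) → n • m = 0) (c : subgroupH1 H M) (hc : resOfLe M hle c = 0) :
    n • c = 0 := by
  obtain ⟨z, rfl⟩ := oneCocycleClass_surjective _ c
  obtain ⟨a, ha⟩ := (CocycleCriteria.resOfLe_oneCocycleClass_eq_zero_iff hle z).mp hc
  -- `b(h) = z(h) − (h·a − a)` is `H'`-fixed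
  have hb : ∀ h : H, ∀ x ∈ H', x • (z.1 h - ((h : G) • a - a)) = z.1 h - ((h : G) • a - a) := by
    intro h x hx
    have hy : (h : G)⁻¹ * x * h ∈ H' := by
      simpa only [inv_inv] using hH'.conj_mem x hx (h : G)⁻¹
    set xH : H := ⟨x, hle hx⟩ with hxH
    set yH : H := ⟨(h : G)⁻¹ * x * h, hle hy⟩ with hyH
    have hmul : xH * h = h * yH := Subtype.ext (by
      simp only [hxH, hyH, Subgroup.coe_mul, ← mul_assoc, mul_inv_cancel, one_mul])
    have hzx : z.1 xH = x • a - a := ha ⟨x, hx⟩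
    have hzy : z.1 yH = ((h : G)⁻¹ * x * h) • a - a := ha ⟨(h : G)⁻¹ * x * h, hy⟩
    have e1 : z.1 (xH * h) = (x • a - a) + x • z.1 h := by
      rw [z.2 xH h, hzx]
      rfl
    have e2 : z.1 (xH * h) = z.1 h + ((x • ((h : G) • a)) - (h : G) • a) := by
      rw [hmul, z.2 h yH, hzy]
      change z.1 h + (h : G) • (((h : G)⁻¹ * x * h) • a - a) = _
      rw [smul_sub, smul_smul, ← mul_assoc, ← mul_assoc, mul_inv_cancel, one_mul, mul_smul]
    have e := eq_sub_of_add_eq' (e1.symm.trans e2)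
    rw [smul_sub, smul_sub, e]
    abel
  -- `n · [z] = [(n : ℤ) · z]` is the coboundary of `n · a`
  have hcl : n • oneCocycleClass _ z = oneCocycleClass _ ((n : ℤ) • z) := by
    rw [oneCocycleClass_smul, Nat.cast_smul_eq_nsmul]
  rw [hcl, oneCocycleClass_eq_zero_iff]
  refine ⟨n • a, fun h ↦ ?_⟩
  rw [Submodule.coe_smul, ContinuousMap.smul_apply, Nat.cast_smul_eq_nsmul]
  change n • z.1 h = (h : G) • (n • a) - n • a
  have hn := hfix _ (hb h)
  rw [smul_sub, sub_eq_zero] at hn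
  rw [hn, smul_sub, smul_comm (h : G) n a]

end InfRes

end Literature.NumberTheory.EllipticCurves


/-! ## §2 Characters vanishing on `ker r` factor through `r` -/

namespace AddMonoidHom

/-- **A character of an abelian group vanishing on `ker r` is of the form `x ∘ r`** (`r : S →+ S'`): it descends to
`S ⧸ ker r ≅ range r` and extends from `range r ≤ S'` to `S'` because `ℚ/ℤ` is divisible
(`CharacterModule.dual_surjective_of_injective`). The endomorphism case is the tree's `exists_comp_eq_of_forall_ker`. [folklore] -/
theorem exists_comp_eq_of_forall_ker_apply {S S' : Type u} [AddCommGroup S] [AddCommGroup S'] (r : S →+ S')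
    (χ : S →+ AddCircle (1 : ℚ)) (hχ : ∀ s : S, r s = 0 → χ s = 0) :
    ∃ x : S' →+ AddCircle (1 : ℚ), ∀ s : S, x (r s) = χ s := by
  -- descend `χ` to the quotient by `ker r`, identified with `range r`
  let χ' : S ⧸ r.ker →+ AddCircle (1 : ℚ) :=
    QuotientAddGroup.lift r.ker χ fun s hs ↦ hχ s (r.mem_ker.mp hs)
  let e : S ⧸ r.ker ≃+ r.range := QuotientAddGroup.quotientKerEquivRange r
  let ξ : r.range →+ AddCircle (1 : ℚ) := χ'.comp e.symm.toAddMonoidHom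
  -- extend `ξ` along the injection `range r ↪ S'`
  have hinj : Function.Injective (r.range.subtype.toIntLinearMap) := fun a b h ↦ Subtype.ext h
  obtain ⟨x, hx⟩ := CharacterModule.dual_surjective_of_injective _ hinj ξ
  let x' : S' →+ AddCircle (1 : ℚ) := x
  refine ⟨x', fun s ↦ ?_⟩
  have h1 : x' (r s) = ξ ⟨r s, ⟨s, rfl⟩⟩ := DFunLike.congr_fun hx ⟨r s, ⟨s, rfl⟩⟩
  have he : e.symm ⟨r s, ⟨s, rfl⟩⟩ = (QuotientAddGroup.mk s : S ⧸ r.ker) := by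
    apply e.injective
    rw [AddEquiv.apply_symm_apply]
    rfl
  have h2 : ξ ⟨r s, ⟨s, rfl⟩⟩ = χ' (QuotientAddGroup.mk s) := by
    show χ' (e.symm ⟨r s, ⟨s, rfl⟩⟩) = _
    rw [he]
  rw [h1, h2]
  rfl

end AddMonoidHom

/-! ## §3 `E[p^∞]`: the kernel of `Sel_𝔭̄(K_∞^{(2)}) → H¹_{nr,𝔭̄}(K̃_∞)` and the cokernel of `toXAc` are killed by the exponent of
`E(K̃_∞)[p^∞]` -/

namespace WeierstrassCurve

open NumberField IsDedekindDomain Field Literature.NumberTheory.EllipticCurves Literature.NumberTheory.GaloisRepresentations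
  Literature.NumberTheory.EllipticCurves.TwoVariableSelmer Literature.NumberTheory.EllipticCurves.Castella2018

variable {K : Type u} [Field K] [NumberField K] (W : WeierstrassCurve K) (p : ℕ) [Fact p.Prime]
  (κ₁ κ₂ : ZpExtension K p) (vbar : HeightOneSpectrum (𝓞 K))

/-- **The kernel of the restriction `Sel_𝔭̄(K_∞^{(2)}, E[p^∞]) → H¹_{nr,𝔭̄}(K̃_∞, E[p^∞])` is killed by the exponent of
`E(K̃_∞)[p^∞] = E[p^∞]^{Gal(K̄/K̃_∞)}`** (inflation–restriction along `pairKer κ₁ κ₂ ≤ ker κ₂`, `nsmul_eq_zero_of_resOfLe_eq_zero`).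
[cite: GreenbergLNM1716, §3 Lemma 3.1 (PDF p. 86)] [cite: SkinnerUrban2014, Prop. 3.2.8 (p. 23)] -/
theorem pow_smul_eq_zero_of_selmerAcToUnrSelmer₂_eq_zero {a : ℕ}
    (hfix : ∀ m : geomPrimaryTorsion W p, (∀ σ ∈ ZpExtension.pairKer κ₁ κ₂, σ • m = m) → p ^ a • m = 0)
    (s : AcSelmer.selmerAc W p κ₂ vbar ∅) (hs : W.selmerAcToUnrSelmer₂ p κ₁ κ₂ vbar s = 0) :
    p ^ a • s = 0 := by
  have hres : W.resOfLe p (ZpExtension.pairKer_le_right κ₁ κ₂) (s : W.subgroupH1 p κ₂.kerSubgroup) = 0 := by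
    rw [← coe_selmerAcToUnrSelmer₂_apply, hs]
    rfl
  have h := nsmul_eq_zero_of_resOfLe_eq_zero (M := geomPrimaryTorsion W p) (ZpExtension.pairKer_le_right κ₁ κ₂)
    hfix (s : W.subgroupH1 p κ₂.kerSubgroup) hres
  exact Subtype.ext (by rw [AddSubgroupClass.coe_nsmul]; exact h)

namespace XGr₂

variable (γ₁ γ₂ : Field.absoluteGaloisGroup K) [Fact (ZpExtension.IsTopGeneratorPair κ₁ κ₂ γ₁ γ₂)]
  [Fact (κ₂.IsTopGenerator γ₂)]

/-- **The cokernel of the control map `X_Gr(E/K̃_∞) → X_ac^∅(E[p^∞])` is killed by the exponent of `E(K̃_∞)[p^∞]`**: if `p^a` kills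
`E[p^∞]^{Gal(K̄/K̃_∞)}` then every `p^a · y` (`y ∈ X_ac^∅ = Hom(Sel_𝔭̄(K_∞^{(2)}), ℚ/ℤ)`) is `toXAc x = x ∘ res` for some
`x ∈ X_Gr₂` — the character `p^a · y` kills `ker(res)` (`pow_smul_eq_zero_of_selmerAcToUnrSelmer₂_eq_zero`) and so factors through `res`
(`AddMonoidHom.exists_comp_eq_of_forall_ker_apply`). The surjective case `E(K)[p] = 0` is the tree's `toXAc_surjective`.
[cite: SkinnerUrban2014, §3.2.7 and Prop. 3.2.8 (p. 23)] [cite: GreenbergLNM1716, §3 Lemma 3.1 (PDF p. 86)] -/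
theorem exists_toXAc_eq_pow_smul {a : ℕ}
    (hfix : ∀ m : geomPrimaryTorsion W p, (∀ σ ∈ ZpExtension.pairKer κ₁ κ₂, σ • m = m) → p ^ a • m = 0)
    (y : AcSelmer.XAc W p κ₂ vbar ∅ γ₂) :
    ∃ x : W.XGr₂ p κ₁ κ₂ vbar γ₁ γ₂, toXAc W p κ₁ κ₂ vbar γ₁ γ₂ x = ((p : IwasawaAlgebra p) ^ a) • y := by
  -- the character `p^a · y` of `Sel_𝔭̄(K_∞^{(2)})` kills `ker(res)`
  let χ : AcSelmer.selmerAc W p κ₂ vbar ∅ →+ AddCircle (1 : ℚ) :=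
    p ^ a • (y : AcSelmer.selmerAc W p κ₂ vbar ∅ →+ AddCircle (1 : ℚ))
  have hχ : ∀ s, W.selmerAcToUnrSelmer₂ p κ₁ κ₂ vbar s = 0 → χ s = 0 := fun s hs ↦ by
    have e1 : χ s = p ^ a • y s := rfl
    rw [e1, ← map_nsmul, W.pow_smul_eq_zero_of_selmerAcToUnrSelmer₂_eq_zero p κ₁ κ₂ vbar hfix s hs, map_zero]
  obtain ⟨x, hx⟩ := AddMonoidHom.exists_comp_eq_of_forall_ker_apply (W.selmerAcToUnrSelmer₂ p κ₁ κ₂ vbar) χ hχ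
  refine ⟨x, DFunLike.ext _ _ fun s ↦ ?_⟩
  have h1 : toXAc W p κ₁ κ₂ vbar γ₁ γ₂ x s = χ s := hx s
  rw [h1, ← Nat.cast_pow, Nat.cast_smul_eq_nsmul]
  rfl

end XGr₂

end WeierstrassCurve

/-! ## §4 (Ctrl) from the fixed-point input; `stub_acDescent` from (FE) and (TPfe) -/

namespace Summit.BirchSwinnertonDyer.BirchSwinnertonDyer.Theorems.AcDescent

open scoped MatrixGroups ModularForm

open CongruenceSubgroup WeierstrassCurve NumberField IsDedekindDomain Field PowerSeries
  Literature.NumberTheory.EllipticCurves Literature.NumberTheory.EllipticCurves.GreenbergSelmer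
  Literature.NumberTheory.EllipticCurves.ModularForms Literature.NumberTheory.QuadraticFields
  Literature.NumberTheory.EllipticCurves.Rank1Residual
  Literature.NumberTheory.EllipticCurves.Rank1Residual.Typed
  Literature.NumberTheory.GaloisRepresentations Literature.NumberTheory.GaloisCohomology
  Literature.NumberTheory.Automorphic
  Summit.BirchSwinnertonDyer.Rank1Residual.X11b.AcSelmer
  Summit.BirchSwinnertonDyer.Rank1Residual.X11b.Halves
  Summit.BirchSwinnertonDyer.Rank1Residual.X11b
  Summit.BirchSwinnertonDyer.Rank1Residual Summit.BirchSwinnertonDyer.Rank1Residual.X1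
  Summit.BirchSwinnertonDyer.Rank1Residual.X2
open Summit.BirchSwinnertonDyer.BirchSwinnertonDyer.Theorems.EisensteinPrimesBSDpOnCellCAccumDefs (TwoVarRatDivPNew)

/-- **(Ctrl) from the fixed-point input**: for an elliptic curve `W` over a number field `K`, a generator pair `(γ₁, γ')` of `(κ₁, κ)`,
a place `v̄`, and `a` with `p^a · E[p^∞]^{Gal(K̄/K̃_∞)} = 0`, the control map `XGr₂.toXAcQuot` repackaged as a `Λ`-linear map on
`QuotSMulTop T₁ X_Gr₂` (constants structure) has cokernel killed by `p^a` (`XGr₂.exists_toXAc_eq_pow_smul`).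
[cite: SkinnerUrban2014, §3.2.7 and Prop. 3.2.8 (p. 23)] [cite: GreenbergLNM1716, §3 Lemma 3.1 (PDF p. 86)] -/
theorem control_of_fixedExponent {K : Type} [Field K] [NumberField K] (W : WeierstrassCurve K)
    (p : ℕ) [Fact p.Prime] (κ₁ κ : ZpExtension K p) (vbar : HeightOneSpectrum (𝓞 K))
    (γ₁ γ' : Field.absoluteGaloisGroup K) [Fact (ZpExtension.IsTopGeneratorPair κ₁ κ γ₁ γ')]
    [Fact (κ.IsTopGenerator γ')] {a : ℕ}
    (hfix : ∀ m : geomPrimaryTorsion W p, (∀ σ ∈ ZpExtension.pairKer κ₁ κ, σ • m = m) → p ^ a • m = 0) :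
    letI : Module (IwasawaAlgebra p) (QuotSMulTop (PowerSeries.X : IwasawaAlgebra₂ p) (W.XGr₂ p κ₁ κ vbar γ₁ γ')) :=
      Module.compHom _ (PowerSeries.C (R := IwasawaAlgebra p))
    ∃ (φ : QuotSMulTop (PowerSeries.X : IwasawaAlgebra₂ p) (W.XGr₂ p κ₁ κ vbar γ₁ γ') →ₗ[IwasawaAlgebra p]
        Castella2018.AcSelmer.XAc W p κ vbar ∅ γ') (a : ℕ),
      ∀ y : Castella2018.AcSelmer.XAc W p κ vbar ∅ γ', ∃ q, ((p : IwasawaAlgebra p) ^ a) • y = φ q := by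
  let e : QuotSMulTop (PowerSeries.X : IwasawaAlgebra₂ p) (W.XGr₂ p κ₁ κ vbar γ₁ γ')
      ≃ₗ[IwasawaAlgebra₂ p] (W.XGr₂ p κ₁ κ vbar γ₁ γ' ⧸
        (Ideal.span {(PowerSeries.X : IwasawaAlgebra₂ p)} •
          (⊤ : Submodule (IwasawaAlgebra₂ p) (W.XGr₂ p κ₁ κ vbar γ₁ γ')))) :=
    Submodule.quotEquivOfEq _ _
      (Submodule.ideal_span_singleton_smul (PowerSeries.X : IwasawaAlgebra₂ p) ⊤).symm
  let ψ := (WeierstrassCurve.XGr₂.toXAcQuot W p κ₁ κ vbar γ₁ γ').comp e.toLinearMap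
  letI : Module (IwasawaAlgebra p) (QuotSMulTop (PowerSeries.X : IwasawaAlgebra₂ p) (W.XGr₂ p κ₁ κ vbar γ₁ γ')) :=
    Module.compHom _ (PowerSeries.C (R := IwasawaAlgebra p))
  refine ⟨{ toFun := ψ
            map_add' := ψ.map_add
            map_smul' := fun c q => ?_ }, a, fun y => ?_⟩
  · show ψ ((PowerSeries.C c : IwasawaAlgebra₂ p) • q) = c • ψ q
    rw [ψ.map_smulₛₗ, PowerSeries.constantCoeff_C]
  · obtain ⟨x, hx⟩ := WeierstrassCurve.XGr₂.exists_toXAc_eq_pow_smul W p κ₁ κ vbar γ₁ γ' hfix y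
    refine ⟨e.symm (Submodule.Quotient.mk x), ?_⟩
    show ((p : IwasawaAlgebra p) ^ a) • y =
      WeierstrassCurve.XGr₂.toXAcQuot W p κ₁ κ vbar γ₁ γ' (e (e.symm (Submodule.Quotient.mk x)))
    rw [LinearEquiv.apply_symm_apply, WeierstrassCurve.XGr₂.toXAcQuot_mk, hx]

/-- **The fixed-point input from `E(K)[p] = 0`** with exponent `p^0`: then `E(K̃_∞)[p^∞] = 0` (pro-`p` fixed-point principle, tree
`eq_zero_of_forall_pairKer_smul_eq`). [cite: GreenbergLNM1716, §4, proof of Prop. 4.8 (PDF p. 109)] -/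
theorem fixedExponent_of_noPTorsion {K : Type} [Field K] [NumberField K] (W : WeierstrassCurve K) [W.IsElliptic]
    (p : ℕ) [Fact p.Prime] {κ₁ κ : ZpExtension K p} {γ₁ γ' : Field.absoluteGaloisGroup K}
    (hγ : ZpExtension.IsTopGeneratorPair κ₁ κ γ₁ γ') (hK : ∀ P : W.toAffine.Point, p • P = 0 → P = 0) :
    ∀ m : geomPrimaryTorsion W p, (∀ σ ∈ ZpExtension.pairKer κ₁ κ, σ • m = m) → p ^ 0 • m = 0 :=
  fun _ hm ↦ by rw [W.eq_zero_of_forall_pairKer_smul_eq hγ hK hm, smul_zero]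

/-- **`stub_acDescent` (crystal v10, VERBATIM) ⟸ (FE) ∧ (TPfe).** (FE) as in `acDescent_of_inputs`; (TPfe): for every minimal elliptic
`W` on cell C at `p`, number field `K`, cyclotomic `κ₁`, anticyclotomic `κ` and generator pair `(γ₁, γ)`:
`∃ a, p^a · E_K[p^∞]^{Gal(K̄/K̃_∞)} = 0` — true for every non-CM curve (no `Γ_K`-stable `p`-divisible line of `E[p^∞]` is rational over
the abelian `K̃_∞`; `E[p] ⊄ E(K̃_∞)` since `μ_p ⊄ K̃_∞`, `p` odd), in particular on all of cell C (multiplicative at `p` ⟹ non-CM), and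
`= p^0` when `E(K)[p] = 0` (`fixedExponent_of_noPTorsion`); NOT proved here. (Ctrl) of `acDescent_of_inputs` is supplied by
`control_of_fixedExponent`. CONDITIONAL; nothing asserted. [cite: GreenbergLNM1716, §3 Lemma 3.1 and §4 Prop. 4.8]
[cite: Greenberg2016Selmer, Prop. 4.1.1] [cite: Ochiai2006, Lemma 7.2 (Compositio Math. 142 pp. 1187–1188)] -/
theorem acDescent_of_inputs_fe
    (hFE : ∀ (W : WeierstrassCurve ℚ) [W.IsElliptic] [W.IsGloballyMinimal] (p : ℕ) [Fact p.Prime], CellC W p →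
      ∀ (K : Type) [Field K] [NumberField K] (κ₁ κ : ZpExtension K p), κ₁.IsCyclotomic → κ.IsAnticyclotomic →
      ∀ (𝔭bar : HeightOneSpectrum (𝓞 K)), ((p : ℕ) : 𝓞 K) ∈ 𝔭bar.asIdeal →
      ∀ (γ₁ γ : Field.absoluteGaloisGroup K) [Fact (ZpExtension.IsTopGeneratorPair κ₁ κ γ₁ γ)],
      ∃ m : ℕ, ∀ x : (W.baseChange K).XGr₂ p κ₁ κ 𝔭bar γ₁ γ,
        (PowerSeries.X : IwasawaAlgebra₂ p) • x = 0 → ((p : IwasawaAlgebra₂ p) ^ m) • x = 0)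
    (hTP : ∀ (W : WeierstrassCurve ℚ) [W.IsElliptic] [W.IsGloballyMinimal] (p : ℕ) [Fact p.Prime], CellC W p →
      ∀ (K : Type) [Field K] [NumberField K] (κ₁ κ : ZpExtension K p), κ₁.IsCyclotomic → κ.IsAnticyclotomic →
      ∀ (γ₁ γ : Field.absoluteGaloisGroup K), ZpExtension.IsTopGeneratorPair κ₁ κ γ₁ γ →
      ∃ a : ℕ, ∀ m : geomPrimaryTorsion (W.baseChange K) p,
        (∀ σ ∈ ZpExtension.pairKer κ₁ κ, σ • m = m) → p ^ a • m = 0) :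
    (∀ (W : WeierstrassCurve ℚ) [W.IsElliptic] [W.IsGloballyMinimal] (p : ℕ) [Fact p.Prime],
      CellC W p → TwoVarRatDivPNew W p) →
    (∀ (W : WeierstrassCurve ℚ) [W.IsElliptic] [W.IsGloballyMinimal] (p : ℕ) [Fact p.Prime],
      CellC W p → ¬ W.HasSplitMultiplicativeReductionAtPrime p → NonsplitKolyvaginDivOnTreeIntOther W p) ∧
    (∀ (W : WeierstrassCurve ℚ) [W.IsElliptic] [W.IsGloballyMinimal] (p : ℕ) [Fact p.Prime],
      CellC W p → W.HasSplitMultiplicativeReductionAtPrime p → SplitKolyvaginDivOnTreeIntOther W p) :=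
  acDescent_of_inputs hFE fun W _ _ p _ hC K _ _ κ₁ κ hκ₁ hκ 𝔭bar _ γ₁ γ hpair _ ↦ by
    obtain ⟨a, ha⟩ := hTP W p hC K κ₁ κ hκ₁ hκ γ₁ γ hpair.out
    exact control_of_fixedExponent (W.baseChange K) p κ₁ κ 𝔭bar γ₁ γ ha

end Summit.BirchSwinnertonDyer.BirchSwinnertonDyer.Theorems.AcDescent

end
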